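import Summits.HodgeConjecture.CorCM.B01.Transposition.HComp.HonestP5OfNonVacuity
import Literature.NumberTheory.Automorphic.Liu2021.AlbaneseExistence
import Literature.NumberTheory.Automorphic.Liu2021.NablaMapSurjectiveOfPieces
import Literature.AlgebraicGeometry.ShimuraVarieties.UnitaryShimuraCurveRecordMorphisms
import Literature.AlgebraicGeometry.ShimuraVarieties.UnitaryShimuraCurveLevelFibres
import Literature.AlgebraicGeometry.Motives.BaseChangeAlgebraicExtension
import Literature.AlgebraicGeometry.Motives.AbelianVarietyEpiTateSurjective
import Summits.HodgeConjecture.CorCM.HypLiu418.A3Liu418IsogenyDescent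
import Literature.NumberTheory.Automorphic.Liu2021.AppendixC.IsogenyDescentOfLevelQuotientHolds
import Literature.NumberTheory.Automorphic.Liu2021.AppendixC.EtaleHeckeDatumOfTranslates
import HarnessLib

/-!
# GS-4: Liu's §4.2 datum of the unitary Shimura CURVE tower over a record-system PARAMETER (the GS instance of line `a3_liu418`)

Cell `hodgecm-mathlib`, crux `HLiu418` (stmt-HodgeConjecture-24832), node **GS-4** of the GS line (GS-PROGRAMME memo §9 A.12 +
addenda; KEY `A-plan/keys/KEY-hodgecm-mathlib-A-gs4-gs-instance.draft.md`; director s91 (4)).  DEFINITIONS + PROVED bookkeeping only: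
no named fact, no `instance`, no `sorry`; every statement is over a bare curve record system
`S : RecordSystemGS F Jstar ι₁ K₀` (★ `UnitaryShimuraCurveRecord.lean`) taken as a PARAMETER, and — where a printed property of
the canonical model is needed — over the ★ GS-2b predicates `S.HeckeTranslateDefinedOver` (u1) and `S.IsLevelQuotient` (u4) of
`UnitaryShimuraCurveRecordMorphisms.lean` taken as HYPOTHESES.  Nothing imports or asserts the GS-3 existence cluster.

Contents (decl names keyed by A-plan2 18:20:45Z (ii); rank-2 twins of the ★ rank-3 `HComp` decls, `3 ↦ 2`):
* §1 `conjSystemGS` · `honestP5GS` · `honestSystemGS` · `smooth_/projective_conjSystemGS_obj` · `smooth_/projective_honestSystemGS_Sh` ·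
  `compactifiedOfGS` · `isProjectiveOver_honestSystemGS_Sh_iff` · **`sec42DataGS S h4 isoₛ : Sec42Data (honestP5GS Jstar K₀ S.M) isoₛ`**
  (★ `Sec42Data.ofAlbanese` + ★ `CompactifiedSystem.ofProjective` + ★ `Albanese.nonempty_of_numberField (d := 1)`) · `sec42DataGS_X` ·
  `sec42DataGS_cpt_X_map`;
* §2 `recordHeckeTranslateGS hU7ₛ` (the translate CHOSEN from u1) · `isHeckeTranslate_recordHeckeTranslateGS` · `heckeTranslatesGS hU7ₛ` ·
  **`sec42HeckeTranslatesGS S hU7ₛ h4 isoₛ`** · `sec42HeckeTranslatesGS_tr` (`rfl` read-out);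
* §3 **`albTransitionEpi_GS`** — (I) every Albanese transition `Alb_{u^{K'}_K}` of the curve tower is an epimorphism (★
  `Sec42Data.epi_Atr_of_pieces_lift_iso` fed with ★ `RecordSystemGS.pieces_pair_lift`) · `hI_GS` (★ `injective_dualMap_rationalTateModuleMap_of_epi`);
* §4 `levelQuotientUP_GS hU7ₛ hLQ` · **`isogenyDescent_GS S hU7ₛ hLQ h4 isoₛ`** (★ `isogenyDescent_of_levelQuotient_holds`);
* §5 **`etaleHeckeDatumGS`** (★ `etaleHeckeDatumOfTranslates ℓ hI_GS (isogenyDescent_GS …)`) · `isInducedBy_etaleHeckeDatumGS`.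

Seams of record (A-p01 g4 SketchGS4 v2 d5b49d23 / A-p17 g5 SketchGS8core 8706f94c): `(honestP5GS …).n - 1` vs `1` is DEFEQ;
`open …Model.HComp` for the §0 index plumbing (`restrictFunctor`, `transportRestrictIso`); DEFAULT heartbeats throughout
(edition 2: the naturality square fed to ★ `Sec42Data.epi_Atr_of_pieces_lift_iso` is transported through `.left` components —
`Over.OverMorphism.ext` + `Over.comp_left` — so the kernel never compares two `Over`-compositions with syntactically different
factors, which is what cost the former `maxHeartbeats 1600000` budget of `albTransitionEpi_GS`); no `recordFunctorOfIso` layer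
at rank 2.  Consumers: the GS-5b/GS-8-core KEY (A-p17 lineage: `towerHomGS`, `seesawSourceGS'`) imports this file.
HC_CM is proved only modulo the 7 printed citations until rung 0 closes; this file moves no book.

## References

* [Liu2021] Y. Liu, *Fourier–Jacobi cycles and arithmetic relative trace formula*, Camb. J. Math. 9 (2021): §4.2 (the datum
  `(X_K, Alb X_K, transitions, Hecke translates)` of a unitary Shimura variety), proof of Thm. 4.15 (the curve `Sh(G⋆, h⋆)`,
  FJcycle.tex l. 2193–2208), App. C Prop. C.5, Def. C.8.
* [Deligne1979ShimuraVarieties] P. Deligne, *Variétés de Shimura …*, PSPM XXXIII.2 (1979): 2.1.4, 2.2.5–2.2.6, 2.7.1 (b)–(c), Cor. 2.7.21.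
* [Milne2005ShimuraVarieties] J. S. Milne, *Introduction to Shimura varieties* (2005/2017): Thm. 13.6 p. 118, Rem. 5.29 (c) p. 65.
-/

set_option autoImplicit false

noncomputable section

namespace Summit.HodgeConjecture.CorCM.Lines.A3Liu418

open CategoryTheory CategoryTheory.Limits AlgebraicGeometry NumberField
open Literature.AlgebraicGeometry.Motives
open Literature.AlgebraicGeometry.ShimuraVarieties.UnitaryCanonicalModel
open Literature.NumberTheory.Automorphic Literature.NumberTheory.Automorphic.UnitaryGroup
open Literature.NumberTheory.Automorphic.Liu2021 Literature.NumberTheory.Automorphic.Liu2021.AppendixC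
open Summit.HodgeConjecture.CorCM.Model Summit.HodgeConjecture.CorCM.Model.HComp

variable {F : CMField} {ι₁ : F →+* ℂ} (Jstar : Matrix (Fin 2) (Fin 2) F)
  (K₀ : C5.OpenCompactSubgroup ↥(finAdelic (↥(maximalRealSubfield F)) F (IsCMField.complexConj F) 2 Jstar))
  (M : C5.SmallLevel K₀ ⥤ SchemeOver F)

/-! ## §1. The honest Prop-C.5 datum of the CURVE `U(J⋆)` (`n := 2`), its system, and Liu's §4.2 datum over a record PARAMETER -/

/-- `K ↦ X_K := M_K ⊗_{F,c} F` — the base change of a level tower along complex conjugation `c` of the CM field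
(rank-2 twin of `HComp.conjSystem`; the body is rank-free). [cite: Liu2021, §4.2 and proof of Thm. 4.15 (FJcycle.tex l. 2193–2208)] -/
def conjSystemGS : C5.SmallLevel K₀ ⥤ SchemeOver F :=
  M ⋙ baseChangeHom (cmConjRingHom F)

/-- The honest Prop-C.5 datum of the curve datum `Gₛ = Res U(J⋆)`: `n := 2`, `G := Gτ τ := U(J⋆)(𝔸_{F⁺,f})`, `fix := refl`,
`Sh τ τ' := K ↦ X_{K ⊓ K₀} ⊗_{F,τ'} τ'(F)` (twin of `HComp.honestP5` with `3 ↦ 2`). [cite: Liu2021, App. C Prop. C.5] -/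
abbrev honestP5GS : PropC5Data (↥(maximalRealSubfield F)) F where
  n := 2
  one_le_n := by norm_num
  𝕍 := Fin 2 → IsDedekindDomain.FiniteAdeleRing (𝓞 F) F
  G := ↥(finAdelic (↥(maximalRealSubfield F)) F (IsCMField.complexConj F) 2 Jstar)
  V := fun _ => Fin 2 → F
  Gτ := fun _ => ↥(finAdelic (↥(maximalRealSubfield F)) F (IsCMField.complexConj F) 2 Jstar)
  fix := fun _ => ContinuousMulEquiv.refl _
  Sh := fun _ τ' => restrictFunctor K₀ ⋙ conjSystemGS Jstar K₀ M ⋙ C5.baseChangeAlong τ'.rangeRestrictField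

/-- Prop. C.5 CONSTRUCTED on `honestP5GS` (twin of `HComp.honestSystem`, verbatim body). [cite: Liu2021, App. C Prop. C.5] -/
abbrev honestSystemGS : IncoherentShimuraSystem (honestP5GS Jstar K₀ M) where
  K₀ := K₀
  Sh𝕍 := conjSystemGS Jstar K₀ M
  iso _ τ' _ :=
    (Functor.leftUnitor (conjSystemGS Jstar K₀ M ⋙ C5.baseChangeAlong τ'.rangeRestrictField)).symm ≪≫
      Functor.isoWhiskerRight (transportRestrictIso K₀).symm (conjSystemGS Jstar K₀ M ⋙ C5.baseChangeAlong τ'.rangeRestrictField) ≪≫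
      Functor.associator _ _ _

/-- Smoothness of relative dimension `1` is stable under the base change `c`. [cite: Liu2021, App. C Prop. C.5] -/
theorem smooth_conjSystemGS_obj (hsm : ∀ K, SmoothOfRelativeDimension 1 (M.obj K).hom) (K : C5.SmallLevel K₀) :
    SmoothOfRelativeDimension 1 ((conjSystemGS Jstar K₀ M).obj K).hom := by
  have := smoothOfRelativeDimension_isStableUnderBaseChange 1
  exact MorphismProperty.pullback_snd (P := @SmoothOfRelativeDimension 1) _ _ (hsm K)

/-- Projectivity is stable under the base change `c`. [cite: Liu2021, App. C Prop. C.5] -/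
theorem projective_conjSystemGS_obj (hpr : ∀ K, IsProjectiveOver (M.obj K)) (K : C5.SmallLevel K₀) :
    IsProjectiveOver ((conjSystemGS Jstar K₀ M).obj K) :=
  letI : Algebra F F := (cmConjRingHom F).toAlgebra
  (hpr K).baseChange_obj F

variable {Jstar K₀} (S : RecordSystemGS F Jstar ι₁ K₀)

/-- `Sh(𝕍)_K = X_K` is smooth of relative dimension `n − 1 = 1` (the defeq `(2 - 1) = 1` is exercised here).
[cite: Liu2021, App. C Prop. C.5] -/
theorem smooth_honestSystemGS_Sh (K : C5.SmallLevel (honestSystemGS Jstar K₀ S.M).K₀) :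
    SmoothOfRelativeDimension ((honestP5GS Jstar K₀ S.M).n - 1) ((honestSystemGS Jstar K₀ S.M).Sh𝕍.obj K).hom :=
  smooth_conjSystemGS_obj Jstar K₀ S.M S.smooth K

/-- `Sh(𝕍)_K = X_K` is projective (the curve record is projective unconditionally). [cite: Liu2021, App. C Prop. C.5] -/
theorem projective_honestSystemGS_Sh (K : C5.SmallLevel (honestSystemGS Jstar K₀ S.M).K₀) :
    IsProjectiveOver ((honestSystemGS Jstar K₀ S.M).Sh𝕍.obj K) :=
  projective_conjSystemGS_obj Jstar K₀ S.M S.projective K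

/-- Def. C.8 in the Compact Case: `X := Sh`, identity comparison maps. [cite: Liu2021, App. C Def. C.8] -/
def compactifiedOfGS : CompactifiedSystem (honestSystemGS Jstar K₀ S.M) :=
  CompactifiedSystem.ofProjective (honestSystemGS Jstar K₀ S.M) (smooth_honestSystemGS_Sh S) (projective_honestSystemGS_Sh S)

/-- The projectivity clause of `Sec42Data` at `n = 2`: both sides hold under `4 ≤ [F:ℚ]` for EVERY isotropy token.
[cite: Liu2021, §4.2] -/
theorem isProjectiveOver_honestSystemGS_Sh_iff (h4 : 4 ≤ Module.finrank ℚ F) (iso : ℕ → Prop)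
    (K : C5.SmallLevel (honestSystemGS Jstar K₀ S.M).K₀) :
    IsProjectiveOver ((honestSystemGS Jstar K₀ S.M).Sh𝕍.obj K) ↔
      ¬ (Module.finrank ℚ (maximalRealSubfield F) = 1 ∧
        (3 ≤ (honestP5GS Jstar K₀ S.M).n ∨ ((honestP5GS Jstar K₀ S.M).n = 2 ∧ ∀ p : ℕ, p.Prime → iso p))) :=
  ⟨fun _ hh => finrank_maximalRealSubfield_ne_one h4 hh.1, fun _ => projective_honestSystemGS_Sh S K⟩

/-- **Liu's §4.2 datum of the curve tower, by-name assembly** over the record parameter `S`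
(★ `Sec42Data.ofAlbanese`, ★ `Albanese.nonempty_of_numberField (d := 1)`). [cite: Liu2021, §4.2 and App. C Def. C.8] -/
def sec42DataGS (h4 : 4 ≤ Module.finrank ℚ F) (iso : ℕ → Prop) : Sec42Data (honestP5GS Jstar K₀ S.M) iso :=
  Sec42Data.ofAlbanese (Nat.le_of_ble_eq_true rfl) (honestSystemGS Jstar K₀ S.M)
    (isProjectiveOver_honestSystemGS_Sh_iff S h4 iso) (compactifiedOfGS S) fun K =>
      haveI := (compactifiedOfGS S).smooth_X K
      Classical.choice
        (Albanese.nonempty_of_numberField (d := (honestP5GS Jstar K₀ S.M).n - 1) ((compactifiedOfGS S).X.obj K)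
          ((compactifiedOfGS S).projective_X K))

/-- Its `X_K` is `M_K ⊗_{F,c} F` on the nose. [cite: Liu2021, §4.2] -/
theorem sec42DataGS_X (h4 : 4 ≤ Module.finrank ℚ F) (iso : ℕ → Prop) (K : C5.SmallLevel K₀) :
    (sec42DataGS S h4 iso).X K = (baseChangeHom (cmConjRingHom F)).obj (S.M.obj K) := rfl

/-- Its compactified system's transition maps are the base-changed record transitions (`rfl`). [cite: Liu2021, §4.2] -/
theorem sec42DataGS_cpt_X_map (h4 : 4 ≤ Module.finrank ℚ F) (iso : ℕ → Prop) {K K' : C5.SmallLevel K₀} (f : K ⟶ K') :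
    (sec42DataGS S h4 iso).cpt.X.map f = (baseChangeHom (cmConjRingHom F)).map (S.M.map f) := rfl

/-! ## §2. Hecke translates of the §4.2 datum, CHOSEN from u1 `S.HeckeTranslateDefinedOver` -/

/-- `T⋆_g : M⋆_K ⟶ M⋆_{K'}` chosen from u1 (mirror of ★ `heckeTranslatesOf`). [cite: Milne2005ShimuraVarieties, Thm. 13.6 p. 118]
[cite: Deligne1979ShimuraVarieties, 2.1.4] -/
def recordHeckeTranslateGS (hU7ₛ : S.HeckeTranslateDefinedOver)
    (g : ↥(finAdelic (↥(maximalRealSubfield F)) F (IsCMField.complexConj F) 2 Jstar)) (K K' : C5.SmallLevel K₀)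
    (hK : C5.HeckeLE g K K') : S.M.obj K ⟶ S.M.obj K' :=
  (hU7ₛ g K K' hK).choose

/-- The chosen morphism IS a Hecke translate. [cite: Milne2005ShimuraVarieties, Thm. 13.6 p. 118] -/
theorem isHeckeTranslate_recordHeckeTranslateGS (hU7ₛ : S.HeckeTranslateDefinedOver)
    (g : ↥(finAdelic (↥(maximalRealSubfield F)) F (IsCMField.complexConj F) 2 Jstar)) (K K' : C5.SmallLevel K₀)
    (hK : C5.HeckeLE g K K') : S.IsHeckeTranslate K K' g (recordHeckeTranslateGS S hU7ₛ g K K' hK) :=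
  (hU7ₛ g K K' hK).choose_spec

/-- **Hecke translates on `honestSystemGS`**: base change along `c` of the chosen record translates; the three laws by the ★
uniqueness lemmas of GS-2b (`heckeTranslate_eq_map_of_le`, `heckeTranslate_unique`, `isHeckeTranslate_comp`, `heckeTranslate_eq_id_of_mem`).
[cite: Milne2005ShimuraVarieties, Thm. 13.6 p. 118] [cite: Liu2021, §4.2] -/
def heckeTranslatesGS (hU7ₛ : S.HeckeTranslateDefinedOver) :
    IncoherentShimuraSystem.HeckeTranslates (honestSystemGS Jstar K₀ S.M) where
  tr g K K' hK := (baseChangeHom (cmConjRingHom F)).map (recordHeckeTranslateGS S hU7ₛ g K K' hK)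
  tr_one := fun {K K'} f => by
    show (baseChangeHom (cmConjRingHom F)).map _ = (baseChangeHom (cmConjRingHom F)).map (S.M.map f)
    rw [S.heckeTranslate_eq_map_of_le f (isHeckeTranslate_recordHeckeTranslateGS S hU7ₛ 1 K K' _)]
  tr_mul := fun g g' {K K' K''} hK hK' => by
    show (baseChangeHom (cmConjRingHom F)).map _ ≫ (baseChangeHom (cmConjRingHom F)).map _ =
      (baseChangeHom (cmConjRingHom F)).map _
    rw [← Functor.map_comp,
      S.heckeTranslate_unique
        (S.isHeckeTranslate_comp (isHeckeTranslate_recordHeckeTranslateGS S hU7ₛ g K K' hK)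
          (isHeckeTranslate_recordHeckeTranslateGS S hU7ₛ g' K' K'' hK'))
        (isHeckeTranslate_recordHeckeTranslateGS S hU7ₛ (g * g') K K'' (hK.mul hK'))]
  tr_self := fun {K k} hk => by
    show (baseChangeHom (cmConjRingHom F)).map _ = 𝟙 ((baseChangeHom (cmConjRingHom F)).obj (S.M.obj K))
    rw [S.heckeTranslate_eq_id_of_mem hk (isHeckeTranslate_recordHeckeTranslateGS S hU7ₛ k K K _),
      CategoryTheory.Functor.map_id]

/-- The same on the §4.2 datum `sec42DataGS` (Compact Case packaging ★ `.ofProjective`). [cite: Liu2021, §4.2 and App. C Def. C.8] -/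
def sec42HeckeTranslatesGS (hU7ₛ : S.HeckeTranslateDefinedOver) (h4 : 4 ≤ Module.finrank ℚ F) (iso : ℕ → Prop) :
    (sec42DataGS S h4 iso).HeckeTranslates :=
  (heckeTranslatesGS S hU7ₛ).ofProjective (Nat.le_of_ble_eq_true rfl) (isProjectiveOver_honestSystemGS_Sh_iff S h4 iso)
    (smooth_honestSystemGS_Sh S) (projective_honestSystemGS_Sh S) _

/-- Its translate IS the base-changed chosen record translate (`rfl`). [cite: Liu2021, §4.2] -/
theorem sec42HeckeTranslatesGS_tr (hU7ₛ : S.HeckeTranslateDefinedOver) (h4 : 4 ≤ Module.finrank ℚ F) (iso : ℕ → Prop)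
    (g : ↥(finAdelic (↥(maximalRealSubfield F)) F (IsCMField.complexConj F) 2 Jstar)) (K K' : C5.SmallLevel K₀)
    (hK : C5.HeckeLE g K K') :
    (sec42HeckeTranslatesGS S hU7ₛ h4 iso).tr g K K' hK =
      (baseChangeHom (cmConjRingHom F)).map (recordHeckeTranslateGS S hU7ₛ g K K' hK) := rfl

/-! ## §3. (I) Every Albanese transition of the curve tower is an epimorphism ⇒ the `hI` binder of ★ `etaleHeckeDatumOfTranslates` -/

section AlbEpi

/-- `ῑ₁ ∘ c = ι₁`: the conjugate complex embedding composed with complex conjugation of the CM field is `ι₁`. [cite: Liu2021, §4.2] -/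
private theorem conj_comp_cmConjRingHom : ((starRingEnd ℂ).comp ι₁).comp (cmConjRingHom F) = ι₁ :=
  RingHom.ext fun x => by
    simp only [RingHom.coe_comp, Function.comp_apply, embedding_cmConjRingHom, starRingEnd_self_apply]

/-- **(I) for the curve tower**: every `Alb_{u^{K'}_K} = (sec42DataGS S h4 iso).Atr f` is an epimorphism of abelian varieties —
★ `Sec42Data.epi_Atr_of_pieces_lift_iso` fed with the fibre-lifting property ★ `RecordSystemGS.pieces_pair_lift` of the curve
record along the comparison `X_K ⊗_{ῑ₁} ℂ ≅ M_K ⊗_{ι₁} ℂ` (★ `baseChangeHomObjIsoOfComp`, natural in `K`).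
[cite: Liu2021, §4.2 (surjectivity of the Albanese transitions) and proof of Thm. 4.15] [cite: Deligne1979ShimuraVarieties, 2.7.1 (c)] -/
theorem albTransitionEpi_GS (h4 : 4 ≤ Module.finrank ℚ F) (iso : ℕ → Prop) ⦃K K' : C5.SmallLevel K₀⦄ (f : K' ⟶ K) :
    Epi ((sec42DataGS S h4 iso).Atr f) := by
  letI : Algebra (F : Type) ℂ := ((starRingEnd ℂ).comp ι₁).toAlgebra
  have hι := conj_comp_cmConjRingHom (ι₁ := ι₁)
  -- `Θ_K : X_K ⊗_{ῑ₁} ℂ = (M_K ⊗_c F) ⊗_{ῑ₁} ℂ ≅ M_K ⊗_{ι₁} ℂ` (★ `baseChangeHomObjIsoOfComp`) is natural in `K`: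
  have hΘ := baseChangeHomObjIsoOfComp_comm (cmConjRingHom F) ((starRingEnd ℂ).comp ι₁) ι₁ hι (S.M.map f)
  -- the same square in the engine's syntactic form `(bcFunctor F ℂ).map (X.map f) ≫ Θ_K = Θ_{K'} ≫ (M.map f) ⊗ ℂ`, proved through
  -- `.left` components (kernel hygiene: no comparison of two `Over`-compositions with syntactically different factors)
  have hu : (AbelianVariety.bcFunctor F ℂ).map ((sec42DataGS S h4 iso).cpt.X.map f) ≫
      (baseChangeHomObjIsoOfComp (cmConjRingHom F) ((starRingEnd ℂ).comp ι₁) ι₁ hι (S.M.obj K)).hom =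
      (baseChangeHomObjIsoOfComp (cmConjRingHom F) ((starRingEnd ℂ).comp ι₁) ι₁ hι (S.M.obj K')).hom ≫
        (baseChangeHom ι₁).map (S.M.map f) := by
    refine Over.OverMorphism.ext ?_
    have h2 := congrArg CommaMorphism.left hΘ
    simp only [Over.comp_left] at h2 ⊢
    exact h2
  obtain ⟨κ, κ', P, P', inj, hP, hcol, inj', hP', hl⟩ := S.pieces_pair_lift f
  haveI := hP
  haveI := hP'
  exact (sec42DataGS S h4 iso).epi_Atr_of_pieces_lift_iso f _ _ ((baseChangeHom ι₁).map (S.M.map f)) hu inj hcol inj' hl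

/-- **The `hI` binder of ★ `etaleHeckeDatumOfTranslates` for the curve tower, BY NAME**: the dual of `V_ℓ(Alb_{u^{K'}_K})` is
injective (★ `AbelianVariety.injective_dualMap_rationalTateModuleMap_of_epi` ∘ `albTransitionEpi_GS`).
[cite: Liu2021, §4.2 and App. C (the étale `H¹` of the Albanese tower)] -/
theorem hI_GS (h4 : 4 ≤ Module.finrank ℚ F) (iso : ℕ → Prop) (ℓ : ℕ) [Fact ℓ.Prime] ⦃K K' : C5.SmallLevel K₀⦄ (f : K' ⟶ K) :
    Function.Injective (AbelianVariety.rationalTateModuleMap ℓ ((sec42DataGS S h4 iso).Atr f)).dualMap :=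
  haveI := albTransitionEpi_GS S h4 iso f
  AbelianVariety.injective_dualMap_rationalTateModuleMap_of_epi ℓ _

end AlbEpi

/-! ## §4. The level-quotient universal property transported to `X⋆_N ⟶ X⋆_K`, and (D) `IsogenyDescent`, from u4 -/

section LevelQuotient

variable (hU7ₛ : S.HeckeTranslateDefinedOver) (hLQ : S.IsLevelQuotient) (h4 : 4 ≤ Module.finrank ℚ F) (isoₛ : ℕ → Prop)

include hLQ in
/-- **`u^N_K : X⋆_N ⟶ X⋆_K` is the quotient of `X⋆_N` by the translates `T⋆_k`, `k ∈ K`, for separated test objects**, granted u4: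
record level (u4; every translate is THE chosen one by ★ `heckeTranslate_unique`) ⟶ base change along `c` along the self-adjunction
`(– ⊗_c F) ⊣ (– ⊗_c F)` (★ `quotUP_map_of_adjunction`, ★ `exists_adjunction_baseChangeHom_cmConj`, ★ `isSeparated_baseChangeHom_obj`).
Mirror of ★ `sec42DataOfFourLe_levelQuotientUP` without its total-record-functor step.
[cite: Deligne1979ShimuraVarieties, 2.7.1 (b)–(c)] [cite: Milne2005ShimuraVarieties, Rem. 5.29 (c) p. 65] -/
theorem levelQuotientUP_GS ⦃N K : C5.SmallLevel K₀⦄ (hNK : N ≤ K) (hn : ∀ k ∈ K.1.1, C5.HeckeLE k N N)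
    (W : SchemeOver F) (f : (sec42DataGS S h4 isoₛ).X N ⟶ W) (hW : IsSeparated W.hom)
    (hf : ∀ (k : ↥(finAdelic (↥(maximalRealSubfield F)) F (IsCMField.complexConj F) 2 Jstar)) (hk : k ∈ K.1.1),
      (sec42HeckeTranslatesGS S hU7ₛ h4 isoₛ).tr k N N (hn k hk) ≫ f = f) :
    ∃! fbar : (sec42DataGS S h4 isoₛ).X K ⟶ W, (sec42DataGS S h4 isoₛ).cpt.X.map (homOfLE hNK) ≫ fbar = f := by
  -- (1) record level, for the family of the CHOSEN translates `T⋆_k`, `k ∈ K`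
  let t : ↥K.1.1 → (S.M.obj N ⟶ S.M.obj N) := fun k =>
    recordHeckeTranslateGS S hU7ₛ (k : ↥(finAdelic (↥(maximalRealSubfield F)) F (IsCMField.complexConj F) 2 Jstar)) N N (hn k k.2)
  obtain ⟨act, hact, hsep⟩ := hLQ hNK (fun k hk n hn' => hn k hk n hn')
  have h1 : ∀ (W : SchemeOver F) (f : S.M.obj N ⟶ W), IsSeparated W.hom → (∀ i, t i ≫ f = f) →
      ∃! fbar : S.M.obj K ⟶ W, S.M.map (homOfLE hNK) ≫ fbar = f := by
    intro W f hW hf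
    refine hsep.2 W f hW fun k => ?_
    have hk' : ((k : ↥(finAdelic (↥(maximalRealSubfield F)) F (IsCMField.complexConj F) 2 Jstar))⁻¹) ∈ K.1.1 :=
      K.1.1.inv_mem k.2
    rw [S.heckeTranslate_unique (hact k)
      (isHeckeTranslate_recordHeckeTranslateGS S hU7ₛ
        ((k : ↥(finAdelic (↥(maximalRealSubfield F)) F (IsCMField.complexConj F) 2 Jstar))⁻¹) N N (hn _ hk'))]
    exact hf ⟨(k : ↥(finAdelic (↥(maximalRealSubfield F)) F (IsCMField.complexConj F) 2 Jstar))⁻¹, hk'⟩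
  -- (2) base change along `c`
  obtain ⟨adj⟩ := exists_adjunction_baseChangeHom_cmConj (F : Type)
  exact quotUP_map_of_adjunction adj (fun W : SchemeOver F => IsSeparated W.hom)
    (fun W : SchemeOver F => IsSeparated W.hom) (fun W hW => isSeparated_baseChangeHom_obj _ W hW)
    t (S.M.map (homOfLE hNK)) h1 W f hW (fun i => hf i i.2)

include hLQ in
/-- **(D) `IsogenyDescent` for the curve tower, from u4 ALONE** (★ `isogenyDescent_of_levelQuotient_holds`: the Albanese trace of a
finite level quotient is a THEOREM over `F ⊂ ℂ`). [cite: Liu2021, App. C (isogeny descent along the tower)]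
[cite: Deligne1979ShimuraVarieties, 2.7.1 (c)] -/
theorem isogenyDescent_GS : (sec42HeckeTranslatesGS S hU7ₛ h4 isoₛ).IsogenyDescent :=
  (sec42HeckeTranslatesGS S hU7ₛ h4 isoₛ).isogenyDescent_of_levelQuotient_holds (levelQuotientUP_GS S hU7ₛ hLQ h4 isoₛ)

end LevelQuotient

/-! ## §5. The étale Hecke datum of the curve tower INDUCED by its translates -/

section Etale

variable (hU7ₛ : S.HeckeTranslateDefinedOver) (hLQ : S.IsLevelQuotient) (h4 : 4 ≤ Module.finrank ℚ F) (isoₛ : ℕ → Prop)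
  (ℓ : ℕ) [Fact ℓ.Prime]

/-- **The étale Hecke datum of the curve tower induced by its translates** (the `Xₛ` field of ★ `SeesawSource` for the curve):
★ `etaleHeckeDatumOfTranslates` at `hI := hI_GS` (§3) and `hD := isogenyDescent_GS` (§4) — hypotheses exactly {u1 `hU7ₛ`, u4 `hLQ`}.
[cite: Liu2021, §4.2 and App. C (the étale `H¹` of the Albanese tower with its Hecke action)] -/
def etaleHeckeDatumGS : (sec42DataGS S h4 isoₛ).EtaleHeckeDatum ℓ :=
  (sec42HeckeTranslatesGS S hU7ₛ h4 isoₛ).etaleHeckeDatumOfTranslates ℓ (hI_GS S h4 isoₛ ℓ)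
    (isogenyDescent_GS S hU7ₛ hLQ h4 isoₛ)

/-- It IS induced by the translates (the `hXₛ` field; ★ `isInducedBy_etaleHeckeDatumOfTranslates`). [cite: Liu2021, §4.2 and App. C] -/
theorem isInducedBy_etaleHeckeDatumGS :
    (etaleHeckeDatumGS S hU7ₛ hLQ h4 isoₛ ℓ).IsInducedBy (sec42HeckeTranslatesGS S hU7ₛ h4 isoₛ) :=
  (sec42HeckeTranslatesGS S hU7ₛ h4 isoₛ).isInducedBy_etaleHeckeDatumOfTranslates ℓ (hI_GS S h4 isoₛ ℓ)
    (isogenyDescent_GS S hU7ₛ hLQ h4 isoₛ)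

end Etale

end Summit.HodgeConjecture.CorCM.Lines.A3Liu418

end
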